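import Summits.MatrixMultiplication.MatrixMultiplication.Theorems.SoloInformedCatalystDoor
import Summits.MatrixMultiplication.MatrixMultiplication.Theorems.SoloInformedCwTwoLevels
import Literature.Computability.AlgebraicComplexity.TensorSemiringSpectrum

/-!
# Structured certificates for `R̃(T_cw,2)`: Kronecker-catalytic and self-similar degenerations (door D11)

The plain certificates of `SoloInformedCwTwoLevels.lean` bound `R̃(T_cw,2)` by `R̲(T_cw,2^{⊠N})^{1/N}`
and cannot pay below level `N = 7` (`seven_le_of_cwTwo_certificate`).  A DEGENERATION between two
polynomial expressions in `T_cw,2` is a finer certificate: universal spectral points are additive under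
`⊕`, multiplicative under `⊠`, normalised (`F⟨n⟩ = n`), at least `1` on non-zero tensors and MONOTONE
UNDER DEGENERATION (Strassen 1988; `IsUniversalSpectralPoint.mono_of_algDegeneratesTo`, proved in the
tree), and `R̃(t) = max_F F(t)` (Strassen duality, proved in the tree).  Hence

* `⟨a⟩ ⊠ t^{⊠n} ⊕ ⟨c⟩ ⊵ t^{⊠(n+1)}` gives the POLYNOMIAL CERTIFICATE `R̃(t)^{n+1} ≤ a·R̃(t)^n + c`
  (`asymptoticRank_pow_succ_le_of_poly_certificate`);
* `z ⊠ ⟨R⟩ ⊵ z ⊠ ⟨m⟩ ⊠ t^{⊠N}` with `z ≠ 0` gives the KRONECKER-CATALYTIC CERTIFICATE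
  `m·R̃(t)^N ≤ R` (`asymptoticRank_pow_le_of_kronecker_catalyst`); `z = ⟨1⟩, m = 1` is the plain one.

For `t = T_cw,2` (door `R̃(T_cw,2) ≤ 3 ⇔ ω = 2`, `SoloInformedCwTwoDoor.lean`):
* **door D11 (self-similar)** `matrixMultiplication_of_cwTensor_two_selfSimilar`: if SOME Kronecker power
  of `T_cw,2` is a degeneration of three copies of the previous one, `⟨3⟩ ⊠ T_cw,2^{⊠n} ⊵ T_cw,2^{⊠(n+1)}`,
  then `ω = 2`;
* **door D11' (Kronecker-catalytic)** `matrixMultiplication_of_cwTensor_two_kroneckerCatalyst`: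
  `z ⊠ ⟨m·3^N⟩ ⊵ z ⊠ ⟨m⟩ ⊠ T_cw,2^{⊠N}` for one `N ≥ 1`, one `m ≥ 1` and one non-zero `z` gives `ω = 2`.
  By T. Fritz's local-global principle for preordered semirings (the tensor semiring is of polynomial
  growth) such catalytic degenerations are also NECESSARY for every strict bound: `R̃(t) < r` implies
  `z ⊠ ⟨m r^N⟩ ⊵ z ⊠ ⟨m⟩ ⊠ t^{⊠N}`-type degenerations for suitable `z, m, N` (arXiv:1810.08667,
  Thm. 2.12 / Cor. 2.18(c); not formalised here, cited for orientation) — so D11' is COMPLETE for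
  `R̃(T_cw,2) < 3 + ε`, every `ε > 0`, exactly like the plain door D1 is complete only in the limit;
* **the record instance** `omega_lt_of_cwTensor_two_level_four_certificate`: the level-4 structured
  certificate `⟨3⟩ ⊠ T_cw,2^{⊠3} ⊕ ⟨9⟩ ⊵ T_cw,2^{⊠4}` would give `R̃(T_cw,2) < 3.26`, hence
  `ω < 2.36 < 2.371339` — a level-FOUR statement about explicit `81 × 81 × 81` tensors that would beat
  the record, whereas no PLAIN certificate of level `≤ 6` can (`seven_le_of_cwTwo_certificate`).
  Numerically (roots of `x⁴ = 3x³ + c`): `c = 0, …, 9` give `R̃ ≤ 3, 3.036, 3.069, 3.101, 3.130, 3.159,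
  3.186, 3.211, 1+√5, 3.2598` and `ω ≤ 2, 2.052, 2.099, 2.143, 2.185, 2.224, 2.260, 2.295, 2.328, 2.3595`;
  `c = 10` no longer pays.  Evidence on which `c` survive the Koszul–Young flattenings of
  Landsberg–Ottaviani / Conner–Gesmundo–Landsberg–Ventura is recorded in the seat's dossier (exact ranks
  of `T_cw,2^{⊠4}` at `p = 4, 5, 6`): `c ≤ 2` is excluded, `3 ≤ c ≤ 9` is not.

HONEST FRAMING: the theorems are short consequences of monotonicity + duality; their content is to turn
`ω`-records into finite degeneration problems between explicit tensors of format `3^N`, with the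
threshold made exact.  Nothing here bounds `R̃(T_cw,2)` below `4`.

[cite: ChristandlVranaZuiddam2023, §1.2, Prop. 1.6]
[cite: BurgisserClausenShokrollahi1997, (15.19)–(15.27)]
[cite: ConnerGesmundoLandsbergVentura2022, p. 3, Thm. 1.2]
[cite: Fritz2018, Thm. 2.12, Cor. 2.18 (arXiv:1810.08667)]
-/

set_option linter.dupNamespace false

noncomputable section

namespace Summit.MatrixMultiplication.MatrixMultiplication.Theorems

open Literature.Computability.AlgebraicComplexity

/-! ## Spectral points under structured degenerations -/

/-- `1 ≤ F(z)` for a universal spectral point `F` and a non-zero tensor `z` (`z ≥ ⟨1⟩`).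
[cite: ChristandlVranaZuiddam2023, §1.2] -/
theorem one_le_spectralPoint_of_ne_zero' {F : SpectralMap ℂ} (hF : IsUniversalSpectralPoint ℂ F)
    {ι κ μ : Type} [Fintype ι] [Fintype κ] [Fintype μ] {z : ι → κ → μ → ℂ} (hz : z ≠ 0) :
    1 ≤ F z := by
  rw [← hF.map_unitTensor_one]
  exact hF.mono _ _ (TensorClass.restrictsTo_unitTensor_one_of_ne_zero hz)

/-- **Polynomial certificate, spectral form**: `⟨a⟩ ⊠ t^{⊠n} ⊕ ⟨c⟩ ⊵ t^{⊠(n+1)}` gives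
`F(t)^{n+1} ≤ a F(t)^n + c` for every universal spectral point `F`.
[cite: ChristandlVranaZuiddam2023, §1.2] [cite: BurgisserClausenShokrollahi1997, Lemma 15.27] -/
theorem spectralPoint_pow_succ_le_of_poly_certificate {F : SpectralMap ℂ}
    (hF : IsUniversalSpectralPoint ℂ F) {ι κ μ : Type} [Fintype ι] [Fintype κ] [Fintype μ]
    (t : ι → κ → μ → ℂ) (n a c : ℕ)
    (h : AlgDegeneratesTo
      (directSumTensor (kroneckerTensor (unitTensor ℂ a) (kroneckerPow t n)) (unitTensor ℂ c))
      (kroneckerPow t (n + 1))) :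
    F t ^ (n + 1) ≤ a * F t ^ n + c := by
  have key := hF.mono_of_algDegeneratesTo h
  rwa [hF.map_kroneckerPow, hF.map_directSum, hF.map_kronecker, hF.map_unitTensor,
    hF.map_kroneckerPow, hF.map_unitTensor] at key

/-- **Kronecker-catalytic certificate, spectral form**: `z ⊠ ⟨R⟩ ⊵ z ⊠ (⟨m⟩ ⊠ t^{⊠N})` with `z ≠ 0`
gives `m F(t)^N ≤ R` for every universal spectral point `F` (`F(z) ≥ 1` cancels).
[cite: ChristandlVranaZuiddam2023, §1.2] [cite: Fritz2018, Thm. 2.12] -/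
theorem spectralPoint_pow_le_of_kronecker_catalyst {F : SpectralMap ℂ}
    (hF : IsUniversalSpectralPoint ℂ F) {ι κ μ ι' κ' μ' : Type} [Fintype ι] [Fintype κ] [Fintype μ]
    [Fintype ι'] [Fintype κ'] [Fintype μ'] (t : ι → κ → μ → ℂ) {z : ι' → κ' → μ' → ℂ} (hz : z ≠ 0)
    {N m R : ℕ}
    (h : AlgDegeneratesTo (kroneckerTensor z (unitTensor ℂ R))
      (kroneckerTensor z (kroneckerTensor (unitTensor ℂ m) (kroneckerPow t N)))) :
    (m : ℝ) * F t ^ N ≤ R := by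
  have key := hF.mono_of_algDegeneratesTo h
  rw [hF.map_kronecker, hF.map_kronecker, hF.map_kronecker, hF.map_unitTensor, hF.map_unitTensor,
    hF.map_kroneckerPow] at key
  have hz1 : 1 ≤ F z := one_le_spectralPoint_of_ne_zero' hF hz
  exact le_of_mul_le_mul_left key (by linarith)

/-! ## Asymptotic-rank forms (Strassen duality) -/

/-- **Polynomial certificate**: `⟨a⟩ ⊠ t^{⊠n} ⊕ ⟨c⟩ ⊵ t^{⊠(n+1)}` gives `R̃(t)^{n+1} ≤ a R̃(t)^n + c`.
[cite: ChristandlVranaZuiddam2023, Prop. 1.6] -/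
theorem asymptoticRank_pow_succ_le_of_poly_certificate {ι κ μ : Type} [Fintype ι] [Fintype κ]
    [Fintype μ] (t : ι → κ → μ → ℂ) (n a c : ℕ)
    (h : AlgDegeneratesTo
      (directSumTensor (kroneckerTensor (unitTensor ℂ a) (kroneckerPow t n)) (unitTensor ℂ c))
      (kroneckerPow t (n + 1))) :
    asymptoticRank t ^ (n + 1) ≤ a * asymptoticRank t ^ n + c := by
  obtain ⟨F, hF, hFt⟩ := (strassen_duality_asymptoticRank_holds ℂ t).2
  rw [← hFt]
  exact spectralPoint_pow_succ_le_of_poly_certificate hF t n a c h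

/-- **Kronecker-catalytic certificate**: `z ⊠ ⟨R⟩ ⊵ z ⊠ (⟨m⟩ ⊠ t^{⊠N})`, `z ≠ 0` gives `m R̃(t)^N ≤ R`.
[cite: ChristandlVranaZuiddam2023, Prop. 1.6] [cite: Fritz2018, Cor. 2.18] -/
theorem asymptoticRank_pow_le_of_kronecker_catalyst {ι κ μ ι' κ' μ' : Type} [Fintype ι] [Fintype κ]
    [Fintype μ] [Fintype ι'] [Fintype κ'] [Fintype μ'] (t : ι → κ → μ → ℂ) {z : ι' → κ' → μ' → ℂ}
    (hz : z ≠ 0) {N m R : ℕ}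
    (h : AlgDegeneratesTo (kroneckerTensor z (unitTensor ℂ R))
      (kroneckerTensor z (kroneckerTensor (unitTensor ℂ m) (kroneckerPow t N)))) :
    (m : ℝ) * asymptoticRank t ^ N ≤ R := by
  obtain ⟨F, hF, hFt⟩ := (strassen_duality_asymptoticRank_holds ℂ t).2
  rw [← hFt]
  exact spectralPoint_pow_le_of_kronecker_catalyst hF t hz h

/-! ## Doors for `T_cw,2` -/

/-- **Door D11 (self-similar certificate)**: if some Kronecker power of the small Coppersmith–Winograd
tensor is a degeneration of three copies of the previous power, `⟨3⟩ ⊠ T_cw,2^{⊠n} ⊵ T_cw,2^{⊠(n+1)}`,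
then `ω = 2` (`F^{n+1} ≤ 3 F^n` forces `F ≤ 3` for every spectral point).
[cite: ConnerGesmundoLandsbergVentura2022, p. 3] [cite: ChristandlVranaZuiddam2023, Prop. 1.6] -/
theorem matrixMultiplication_of_cwTensor_two_selfSimilar
    (h : ∃ n : ℕ, AlgDegeneratesTo
      (directSumTensor (kroneckerTensor (unitTensor ℂ 3) (kroneckerPow (cwTensor ℂ 2) n))
        (unitTensor ℂ 0))
      (kroneckerPow (cwTensor ℂ 2) (n + 1))) :
    _root_.MatrixMultiplication := by
  obtain ⟨n, h⟩ := h
  refine matrixMultiplication_of_forall_spectralPoint_cwTensor_two_le_three fun F hF => ?_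
  have key := spectralPoint_pow_succ_le_of_poly_certificate hF (cwTensor ℂ 2) n 3 0 h
  have h0 : 0 ≤ F (cwTensor ℂ 2) := hF.nonneg _
  push_cast at key
  rw [add_zero, pow_succ] at key
  rcases h0.eq_or_lt with h00 | hpos
  · rw [← h00]; norm_num
  · exact le_of_mul_le_mul_left (by linarith [key]) (pow_pos hpos n)

/-- **Door D11' (Kronecker-catalytic certificate)**: a degeneration `z ⊠ ⟨m·3^N⟩ ⊵ z ⊠ ⟨m⟩ ⊠ T_cw,2^{⊠N}`
for one `N ≥ 1`, one `m ≥ 1` and one non-zero tensor `z` (any format) gives `ω = 2`.  By Fritz's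
local-global principle such degenerations exist for every `r > R̃(T_cw,2)` in place of `3`
(arXiv:1810.08667, Cor. 2.18(c); informal, not used).
[cite: Fritz2018, Cor. 2.18] [cite: ChristandlVranaZuiddam2023, Prop. 1.6] -/
theorem matrixMultiplication_of_cwTensor_two_kroneckerCatalyst {ι' κ' μ' : Type} [Fintype ι']
    [Fintype κ'] [Fintype μ'] {z : ι' → κ' → μ' → ℂ} (hz : z ≠ 0) {N m : ℕ} (hN : N ≠ 0)
    (hm : m ≠ 0)
    (h : AlgDegeneratesTo (kroneckerTensor z (unitTensor ℂ (m * 3 ^ N)))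
      (kroneckerTensor z (kroneckerTensor (unitTensor ℂ m) (kroneckerPow (cwTensor ℂ 2) N)))) :
    _root_.MatrixMultiplication := by
  refine matrixMultiplication_of_asymptoticRank_cwTensor_two_le_three ?_
  have key := asymptoticRank_pow_le_of_kronecker_catalyst (cwTensor ℂ 2) hz h
  have hm' : (0 : ℝ) < m := by exact_mod_cast Nat.pos_of_ne_zero hm
  push_cast at key
  have h3 : asymptoticRank (cwTensor ℂ 2) ^ N ≤ (3 : ℝ) ^ N :=
    le_of_mul_le_mul_left (by linarith [key]) hm'
  exact le_of_pow_le_pow_left₀ hN (by norm_num) h3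

/-! ## The record instance at level four -/

/-- **Level-4 structured certificate ⇒ `R̃(T_cw,2) < 3.26`**: `⟨3⟩ ⊠ T_cw,2^{⊠3} ⊕ ⟨9⟩ ⊵ T_cw,2^{⊠4}`
gives `x⁴ ≤ 3x³ + 9` for `x = R̃(T_cw,2)`, and `x⁴ - 3x³ - 9 > 0` for `x ≥ 3.26`
(`3.26³ · 0.26 = 9.008 > 9`). [cite: ChristandlVranaZuiddam2023, Prop. 1.6]
[cite: ConnerGesmundoLandsbergVentura2022, Thm. 1.2] -/
theorem asymptoticRank_cwTensor_two_lt_of_level_four_certificate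
    (h : AlgDegeneratesTo
      (directSumTensor (kroneckerTensor (unitTensor ℂ 3) (kroneckerPow (cwTensor ℂ 2) 3))
        (unitTensor ℂ 9))
      (kroneckerPow (cwTensor ℂ 2) 4)) :
    asymptoticRank (cwTensor ℂ 2) < 3.26 := by
  have key := asymptoticRank_pow_succ_le_of_poly_certificate (cwTensor ℂ 2) 3 3 9 h
  push_cast at key
  set x := asymptoticRank (cwTensor ℂ 2) with hx
  have hx0 : 0 ≤ x := asymptoticRank_nonneg _
  by_contra hge
  rw [not_lt] at hge
  have h3 : (3.26 : ℝ) ^ 3 ≤ x ^ 3 := pow_le_pow_left₀ (by norm_num) hge 3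
  have h4 : (3.26 : ℝ) ^ 3 * 0.26 ≤ x ^ 3 * (x - 3) :=
    mul_le_mul h3 (by linarith) (by norm_num) (pow_nonneg hx0 3)
  have e : x ^ 4 = x ^ 3 * (x - 3) + 3 * x ^ 3 := by ring
  norm_num at h4
  linarith

/-- The numerics: `log₂(4 · 3.26³ / 27) < 2.36` (`(4·3.26³/27)^25 < 2^59`, exact rational arithmetic).
[cite: CoppersmithWinograd1990, §6] -/
theorem logb_cw_formula_at_326_lt : Real.logb 2 (4 * (3.26 : ℝ) ^ 3 / 27) < 2.36 := by
  have hy0 : (0 : ℝ) < 4 * (3.26 : ℝ) ^ 3 / 27 := by norm_num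
  have hy : (4 * (3.26 : ℝ) ^ 3 / 27) ^ 25 < (2 : ℝ) ^ 59 := by norm_num
  rw [Real.logb_lt_iff_lt_rpow (by norm_num : (1 : ℝ) < 2) hy0]
  calc 4 * (3.26 : ℝ) ^ 3 / 27
      = ((4 * (3.26 : ℝ) ^ 3 / 27) ^ 25) ^ ((25 : ℕ) : ℝ)⁻¹ :=
        (Real.pow_rpow_inv_natCast hy0.le (by norm_num)).symm
    _ < ((2 : ℝ) ^ 59) ^ ((25 : ℕ) : ℝ)⁻¹ := Real.rpow_lt_rpow (by positivity) hy (by positivity)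
    _ = (2 : ℝ) ^ (2.36 : ℝ) := by
        rw [← Real.rpow_natCast (2 : ℝ) 59, ← Real.rpow_mul (by norm_num : (0 : ℝ) ≤ 2)]
        norm_num

/-- **The record instance**: the level-4 structured certificate `⟨3⟩ ⊠ T_cw,2^{⊠3} ⊕ ⟨9⟩ ⊵ T_cw,2^{⊠4}`
— a degeneration between explicit tensors of format `81 + 9 = 90` and `81` — would give
`ω < 2.36 < 2.371339`, below every upper bound on `ω` known in 2026; compare
`seven_le_of_cwTwo_certificate`: no plain certificate `R̲(T_cw,2^{⊠N}) ≤ 3.269^N` exists for `N ≤ 6`.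
[cite: ConnerGesmundoLandsbergVentura2022, Thm. 1.2, p. 3] [cite: CoppersmithWinograd1990, §6] -/
theorem omega_lt_of_cwTensor_two_level_four_certificate
    (h : AlgDegeneratesTo
      (directSumTensor (kroneckerTensor (unitTensor ℂ 3) (kroneckerPow (cwTensor ℂ 2) 3))
        (unitTensor ℂ 9))
      (kroneckerPow (cwTensor ℂ 2) 4)) :
    omega ℂ < 2.36 :=
  (omega_le_logb_of_asymptoticRank_cwTensor_lt (le_refl 2)
    (asymptoticRank_cwTensor_two_lt_of_level_four_certificate h)).trans_lt logb_cw_formula_at_326_lt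

/-- **General level-`(n+1)` structured certificates versus plain ones**: `⟨a⟩ ⊠ T_cw,2^{⊠n} ⊕ ⟨c⟩ ⊵
T_cw,2^{⊠(n+1)}` with `a ≤ 3` bounds every spectral point `F = F(T_cw,2) ≥ 3` by `F^{n+1} ≤ 3F^n + c`;
in particular `c = 0` forces `F ≤ 3` (door D11) and in general `F^n (F - 3) ≤ c`: the saving over the
plain certificate `F^{n+1} ≤ R̲(T_cw,2^{⊠(n+1)})` is that only the EXCESS over `3F^n` is paid for.
[cite: ChristandlVranaZuiddam2023, §1.2] -/
theorem spectralPoint_cwTensor_two_excess_le {F : SpectralMap ℂ} (hF : IsUniversalSpectralPoint ℂ F)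
    {n a c : ℕ} (ha : a ≤ 3)
    (h : AlgDegeneratesTo
      (directSumTensor (kroneckerTensor (unitTensor ℂ a) (kroneckerPow (cwTensor ℂ 2) n))
        (unitTensor ℂ c))
      (kroneckerPow (cwTensor ℂ 2) (n + 1))) :
    F (cwTensor ℂ 2) ^ n * (F (cwTensor ℂ 2) - 3) ≤ c := by
  have key := spectralPoint_pow_succ_le_of_poly_certificate hF (cwTensor ℂ 2) n a c h
  have ha' : (a : ℝ) ≤ 3 := by exact_mod_cast ha
  have hFn : 0 ≤ F (cwTensor ℂ 2) ^ n := pow_nonneg (hF.nonneg _) n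
  have e : F (cwTensor ℂ 2) ^ n * (F (cwTensor ℂ 2) - 3) =
      F (cwTensor ℂ 2) ^ (n + 1) - 3 * F (cwTensor ℂ 2) ^ n := by ring
  rw [e]
  nlinarith [mul_le_mul_of_nonneg_right ha' hFn]

end Summit.MatrixMultiplication.MatrixMultiplication.Theorems

end
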